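import Literature.MathematicalPhysics.QuantumFieldTheory.Balaban1983to89.B6L2BlockCalculus
import Literature.MathematicalPhysics.QuantumFieldTheory.Balaban1983to89.B6BlockDecayGLapBridgeV1

/-!
# `Balaban1983to89.B6L2Block114GEV1` — T. Bałaban, *Propagators and renormalization transformations for lattice gauge theories. II*,
# Commun. Math. Phys. **96** (1984) 223–250 [Balaban1984PropagatorsII], PROPOSITION 2.5 p. 246 / [4] = *Propagators … I*, CMP **95** (1984) 17–40
# [Balaban1984PropagatorsI], PROPOSITION 1.2 (1.114), ITS MEMBERS `‖ζ∇∇GJ‖` AND `‖ζ∇G∇*J‖`, FOR THE ONE-LEVEL PROPAGATOR `G^{(w′)} = G_j` READ ON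
# THE TWO-SCALE CARRIERS AS `ℓ²`-BLOCK BOUNDS: for every pair of directions `λ, μ`, the operators `∇_λ∇_μG^{(w′)}`, `∇_λG^{(w′)}∇_μ*` (and, by
# adjunction, `G^{(w′)}∇_μ*∇_λ*`) satisfy `|⟨v, f u⟩| ≤ O(1)·e^{−δ₀|y−y′|}‖v‖‖u‖` for fine bond fields `v`, `u` supported over the blocks `B^j(y)`,
# `B^j(y′)` — uniformly in the volume and in the scale `0 ≤ j ≤ m + K` — the singular inputs of the `ℓ²`-block programme for the two-derivative
# members of (1.114) for the two-scale `G` of (2.90) (file 24; tool: file 23 `…B6L2BlockCalculus`)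

statement-level skeleton of published theorems with citation tags; proofs where landed; nothing here is a claim about the Yang–Mills mass gap

PDF held: `paper:balaban1984-cmp96-propagators-rt-ii` (journal page = PDF page + 222): p. 246 [PDF 24]; `paper:balaban1984-cmp95-propagators-rt-i` ([4];
journal page = PDF page + 16): Prop. 1.2 p. 36 [PDF 20].  PRINT (verbatim).  [4] (1.114) p. 36: *"Finally there exists a constant O(1) such that
‖ζGJ‖, ‖ζ∇GJ‖, ‖ζG∇*J‖, ‖ζ∇G∇*J‖, ‖ζ∇∇GJ‖, ‖ζG∇*∇*J‖ ≤ O(1)e^{−δ₀|y−y′|}|ζ|‖J‖ (1.114) for supp ζ ⊂ Δ̃(y), supp J ⊂ Δ̃(y′)."*  [B6] p. 246: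
*"… From these representations we obtain all the necessary properties of the operators H_j, G̃_j. They follow from the Proposition 1.2 …"*.

CITATION HEADER (lean-in-tree rule) — WHAT IS REPRODUCED.  Phase-2 file of the `lit-balaban` typed skeleton (HOME `run/shared/lean/pub/lit-balaban/`),
seat **p22 gen 16**, lane B6 §C (fold owner r03, referee ref-4); SKELETON row **B6.Prop2.5** (cells only).  The tree PROVES [4] (1.114) for
`G = Δ_a⁻¹` on every torus `T_η`, `η = 1/n`, ALL `n ≥ 1`, all six members, constants `const114 d a`, `delta114 d a` depending on `d, a` only
(b05/r02: `…B5Local114GLattice.l2locL_le_printed`, a Combes–Thomas route).  THIS FILE transports its members `m = 4` (`‖ζ∇∇GJ‖`) and `m = 3`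
(`‖ζ∇G∇*J‖`) to r03's one-level `G^{(w′)} = GE (whole torus of order j)` (`c = L^j`, weight `w′ = a·n^{d+1}`) on the fine bond fields of `T^{(0)}`,
in the `ℓ²`-BLOCK form of file 23: §1 the vector dictionaries `(∇_μx)~ = ∇_μx̃` (`TV_D`: r02's `fdiff`, factor `n`), `(∇_μ*x)~ = ∇_μ*x̃` (`TV_Dadj`),
`(x↾B(y))~ = 1_{B(y)}·x̃` (`TV_blockCut`, r02's `smulV`), `Σ|x̃|² = ‖x‖²` (`nsq_TV`, `l2_TV`), with r03's `TV`, `TV_GE` (`(G^{(w′)}x)~ = Δ_a⁻¹x̃`) and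
p19's `EK`; §2 the abstract step *"a bound on `‖(fu)↾B(y)‖` for `u` over `B(y′)` is an `ℓ²`-block bound"* (`l2blk_of_norm_restrict_le`); §3
**`norm_blockCut_DDGE_le`** / **`l2blk_DDGE_scaling`**: `‖(∇_λ∇_μG^{(w′)}u)↾B(y)‖ ≤ const114·e^{−delta114·|y−y′|_T}‖u‖` and the `ℓ²`-block bound of
`∇_λ∇_μG^{(w′)}` ([4]'s member `m = 4` with the indicator of `B(y)` as cut-off, `|ζ| ≤ 1`, the `(λ, μ)` component below the tensor norm, the block
inside the cube `Δ̃` — p19's `EK_mem_cubeT_blk`); **`l2blk_GEDadjDadj_scaling`** for `G^{(w′)}∇_μ*∇_λ* = (∇_λ∇_μG^{(w′)})*` (`adjoint_DDGE`: r03's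
`inner_GE_left`, p22's `adjoint_Dop`; file 23's `l2blk_adjoint`); §4 **`norm_blockCut_DGEDadj_le`** / **`l2blk_DGEDadj_scaling`**: the same for
`∇_λG^{(w′)}∇_μ*` ([4]'s member `m = 3` on the tensor source `T_ν = δ_{νμ}ũ`, `∇*T = ∇_μ*ũ`).
IMPORTS BY NAME, restating nothing.  THEOREMS ONLY (no `def`, no `def … : Prop`); standard axioms.
HONEST SCOPE: (i) the ONE-LEVEL `G^{(w′)} = G_j` only — [4]'s theorem transported; the two-scale `G` of (2.90) needs in addition the smooth factors
of (2.129) in `ℓ²`-block form and the assembly (the unit's GEN17 plan, sequel files); (ii) finite tori `⟨d + 1, L, m, K, _, _⟩`, `L` odd `> 1`,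
`c = L^j`, weight `a·n^{d+1}`, `a > 0`, every `0 ≤ j ≤ m + K`; (iii) `ℓ²` norms are the unweighted ones on both sides ((1.114) is homogeneous);
(iv) constants `const114 (d+1) a`, `delta114 (d+1) a` of the tree's (1.114), ours and crude; NOT summit progress.  Unit `lit-balaban-p22` (gen 16), 2026-08-22.
-/

noncomputable section

open scoped InnerProductSpace BigOperators Matrix
open Finset

namespace Literature.MathematicalPhysics.QuantumFieldTheory.Balaban1983to89.B6L2Block114GEV1

open LatticeFieldCalculus B5SectBStatements B5Eq117TorusCarriers B6SectADomainsV1 B6SectAOperatorsV1 B6SectAVectorModelV1 B6SectCOperators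
  B6SectCTwoScaleV1 B6SectCTwoScaleV1Lattice B5Eq118OneStroke
open BalabanImbrieJaffe1984to88.BIJ85AxialPropagator411 (BondSpace)
open B4TorusKernel.MultiPeriod (torusSupNorm torusSupNorm_nonneg)
open B4Sect5Torus (IsPseudoDist)
open B5Prop11Plancherel (Tor fine unitVec fdiff)
open B5Prop11Lower (nsq nsq_nonneg)
open B5Prop11Lattice (l2 l2T grad grad2 divT)
open B5Prop11SettingModel (Loc189 locNorm)
open B5DeltaA169 (DeltaA)
open B5Prop12FieldsLattice (distSite cubeT cutInL cutSupL suppInL smulV smulT l2locL l2locL_four_vec l2locL_three_ten)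
open B5Local114GLattice (l2locL_le_printed const114 delta114 const114_pos delta114_pos)
open B5CombesThomasLattice (fdiff_apply)
open B5G183FreeRowSum (fdiff_conjTranspose_mulVec)
open B6LowerBound2153Torus (rep)
open B6HjGtOpNormV1 (qpE_whole_eq_zero_iff inner_QE_aE_whole)
open B6GOneLevelV1Bridge (TV TV_apply TV_apply_EK TV_GE bondEK bondEK_apply)
open B6BlockDecayCalculus (torusDist_isPseudoDist)
open B6BlockDecayHprimeCovV1 (supDist_cast_eq_torusSupNorm)
open B6BlockDecayGDivBridgeV1 (Dadj_apply EK_symm_sub_unitVec adjoint_Dop)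
open B6BlockDecayGLapBridgeV1 (D_apply)
open BalabanImbrieJaffe1984to88.BIJ85Thm711TorusTransport (EK_shift)
open BalabanImbrieJaffe1984to88.BIJ85Prop12BridgeGeometry (supDist_cast_eq_distSite EK_mem_cubeT_blk)
open LatticeNorms (supNorm supNorm_le)
open B6L2BlockCalculus (restrict_eq_self_of_support inner_restrict_left_eq l2blk_adjoint)

/-! ## §1  The vector dictionaries: differences, block cuts and `ℓ²` norms of fine bond fields read on r02's torus -/

section Dictionary

variable {d L m K : ℕ} [NeZero L] {hd : 1 ≤ d + 1} {hL : Odd L ∧ 1 < L} {j : ℕ} (hj' : j ≤ (⟨d + 1, L, m, K, hd, hL⟩ : Params).m + (⟨d + 1, L, m, K, hd, hL⟩ : Params).K)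

omit [NeZero L] in
/-- `EK⁻¹(z + e_μ) = (EK⁻¹z) + e_μ` (p19's `EK_shift` read backwards). [cite: Balaban1984PropagatorsI, (1.18) p.20] -/
theorem EK_symm_add_unitVec (z : Tor (fine (L ^ j) (Mk (⟨d + 1, L, m, K, hd, hL⟩ : Params) j))) (μ : Fin (d + 1)) :
    (EK hj').symm (z + unitVec (fine (L ^ j) (Mk (⟨d + 1, L, m, K, hd, hL⟩ : Params) j)) μ) = ((EK hj').symm z).shift μ := by
  apply (EK hj').injective
  rw [Equiv.apply_symm_apply, EK_shift hj', Equiv.apply_symm_apply]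

/-- **`(∇_μx)~ = ∇_μx̃`**: the forward difference `n(S_μ − I)x` of a fine bond field read on the torus is r02's `fdiff` (factor `n = L^j`) of `x̃`.
[cite: Balaban1984PropagatorsI, (1.31) p.23, (1.18) p.20] -/
theorem TV_D (μ : Fin (d + 1)) (x : BondSpace (⟨d + 1, L, m, K, hd, hL⟩ : Params)) :
    TV hj' (((((L : ℝ) ^ j) • (onE (LinearMap.funLeft ℝ ℝ (fun b : PBond (⟨d + 1, L, m, K, hd, hL⟩ : Params) 0 => (⟨b.src.shift μ, b.dir⟩ : PBond (⟨d + 1, L, m, K, hd, hL⟩ : Params) 0))) - LinearMap.id) : BondSpace (⟨d + 1, L, m, K, hd, hL⟩ : Params) →ₗ[ℝ] BondSpace (⟨d + 1, L, m, K, hd, hL⟩ : Params))) x) = fdiff (fine (L ^ j) (Mk (⟨d + 1, L, m, K, hd, hL⟩ : Params) j)) ((L ^ j : ℕ) : ℂ) μ *ᵥ TV hj' x := by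
  funext b
  obtain ⟨z, κ⟩ := b
  rw [fdiff_apply, show B5CombesThomasLattice.nb (L ^ j) (Mk (⟨d + 1, L, m, K, hd, hL⟩ : Params) j) μ (z, κ) = (z + unitVec (fine (L ^ j) (Mk (⟨d + 1, L, m, K, hd, hL⟩ : Params) j)) μ, κ) from rfl,
    TV_apply, TV_apply, TV_apply, EK_symm_add_unitVec hj', D_apply,
    show (⟨(EK hj').symm z, κ⟩ : PBond (⟨d + 1, L, m, K, hd, hL⟩ : Params) 0).src = (EK hj').symm z from rfl, show (⟨(EK hj').symm z, κ⟩ : PBond (⟨d + 1, L, m, K, hd, hL⟩ : Params) 0).dir = κ from rfl]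
  push_cast
  ring

/-- **`(∇_μ*x)~ = ∇_μ*x̃`**: the backward difference `n(S_μ⁻¹ − I)x` read on the torus is the adjoint `fdiff*` of `x̃`.
[cite: Balaban1984PropagatorsI, (1.31) p.23, (1.89) p.33 («∇*»)] -/
theorem TV_Dadj (μ : Fin (d + 1)) (x : BondSpace (⟨d + 1, L, m, K, hd, hL⟩ : Params)) :
    TV hj' (((((L : ℝ) ^ j) • (onE (LinearMap.funLeft ℝ ℝ (fun b : PBond (⟨d + 1, L, m, K, hd, hL⟩ : Params) 0 => (⟨b.src.unshift μ, b.dir⟩ : PBond (⟨d + 1, L, m, K, hd, hL⟩ : Params) 0))) - LinearMap.id) : BondSpace (⟨d + 1, L, m, K, hd, hL⟩ : Params) →ₗ[ℝ] BondSpace (⟨d + 1, L, m, K, hd, hL⟩ : Params))) x) = star (fdiff (fine (L ^ j) (Mk (⟨d + 1, L, m, K, hd, hL⟩ : Params) j)) ((L ^ j : ℕ) : ℂ) μ) *ᵥ TV hj' x := by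
  funext b
  obtain ⟨z, κ⟩ := b
  rw [Matrix.star_eq_conjTranspose, fdiff_conjTranspose_mulVec]
  dsimp only
  rw [TV_apply, TV_apply, TV_apply, EK_symm_sub_unitVec hj', Dadj_apply,
    show (⟨(EK hj').symm z, κ⟩ : PBond (⟨d + 1, L, m, K, hd, hL⟩ : Params) 0).src = (EK hj').symm z from rfl, show (⟨(EK hj').symm z, κ⟩ : PBond (⟨d + 1, L, m, K, hd, hL⟩ : Params) 0).dir = κ from rfl,
    map_natCast]
  push_cast
  ring

omit [NeZero L] in
/-- **`(x↾B(y))~ = 1_{B(y)}·x̃`**: the restriction of a fine bond field to the bonds over the block `B^j(y)`, read on the torus, is r02's cut-off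
multiplication `smulV` by the indicator of the block. [cite: Balaban1984PropagatorsI, Prop. 1.2 (1.114) p.36 («ζ»)] -/
theorem TV_blockCut (y : Site (⟨d + 1, L, m, K, hd, hL⟩ : Params) j) (x : BondSpace (⟨d + 1, L, m, K, hd, hL⟩ : Params)) :
    TV hj' (WithLp.toLp 2 (fun b : PBond (⟨d + 1, L, m, K, hd, hL⟩ : Params) 0 => if iterBlockOf j b.src = y then x b else 0)) =
      smulV (L ^ j) (Mk (⟨d + 1, L, m, K, hd, hL⟩ : Params) j) (fun z => if iterBlockOf j ((EK hj').symm z) = y then (1 : ℝ) else 0) (TV hj' x) := by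
  funext b
  obtain ⟨z, κ⟩ := b
  show TV hj' _ (z, κ) = ((if iterBlockOf j ((EK hj').symm z) = y then (1 : ℝ) else 0 : ℝ) : ℂ) * TV hj' x (z, κ)
  rw [TV_apply, TV_apply]
  show (((if iterBlockOf j ((EK hj').symm z) = y then x ⟨(EK hj').symm z, κ⟩ else 0 : ℝ)) : ℂ) = _
  split_ifs <;> simp

/-- **`Σ|x̃|² = ‖x‖²`** (p19's bond reindexing `bondEK`). [cite: Balaban1984PropagatorsI, (1.89) p.33 («‖J‖»)] -/
theorem nsq_TV (x : BondSpace (⟨d + 1, L, m, K, hd, hL⟩ : Params)) : nsq (TV hj' x) = ‖x‖ ^ 2 := by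
  rw [nsq, EuclideanSpace.real_norm_sq_eq, ← Equiv.sum_comp (bondEK hj')]
  refine Finset.sum_congr rfl fun b _ => ?_
  rw [bondEK_apply, TV_apply_EK, Complex.norm_real, Real.norm_eq_abs, sq_abs]

/-- `‖x̃‖ = ‖x‖`. [cite: Balaban1984PropagatorsI, (1.89) p.33 («‖J‖»)] -/
theorem l2_TV (x : BondSpace (⟨d + 1, L, m, K, hd, hL⟩ : Params)) : l2 (TV hj' x) = ‖x‖ := by
  rw [l2, nsq_TV, Real.sqrt_sq (norm_nonneg _)]

end Dictionary

/-! ## §2  A bound on the block restrictions of `fu` is an `ℓ²`-block bound -/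

section Abstract

variable {Y : Type*} {ρ : Y → Y → ℝ} {ι κ : Type} [Fintype ι] [Fintype κ]

/-- if `‖(fu)↾y‖ ≤ C e^{−δρ(y,y′)}‖u‖` for every `u` supported over the fibre of `y′`, then `|⟨v, fu⟩| ≤ C e^{−δρ(y,y′)}‖v‖‖u‖` for `v` over the fibre
of `y` (`⟨v, fu⟩ = ⟨v, (fu)↾y⟩`, Cauchy–Schwarz). [cite: Balaban1984PropagatorsI, Prop. 1.2 (1.114) p.36 (bookkeeping, ours)] -/
theorem l2blk_of_norm_restrict_le [DecidableEq Y] (f : EuclideanSpace ℝ κ →ₗ[ℝ] EuclideanSpace ℝ ι) (pι : ι → Y) (pκ : κ → Y) {C δ : ℝ}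
    (h : ∀ (y y' : Y) (u : EuclideanSpace ℝ κ), (∀ k, pκ k ≠ y' → u k = 0) →
      ‖(WithLp.toLp 2 (fun i => if pι i = y then f u i else 0) : EuclideanSpace ℝ ι)‖ ≤ C * Real.exp (-(δ * ρ y y')) * ‖u‖)
    (y y' : Y) (v : EuclideanSpace ℝ ι) (u : EuclideanSpace ℝ κ) (hv : ∀ i, pι i ≠ y → v i = 0) (hu : ∀ k, pκ k ≠ y' → u k = 0) :
    |⟪v, f u⟫_ℝ| ≤ C * Real.exp (-(δ * ρ y y')) * (‖v‖ * ‖u‖) := by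
  have hv' : (WithLp.toLp 2 (fun i => if pι i = y then v i else 0) : EuclideanSpace ℝ ι) = v := restrict_eq_self_of_support pι v y hv
  have hin : ⟪v, f u⟫_ℝ = ⟪v, (WithLp.toLp 2 (fun i => if pι i = y then f u i else 0) : EuclideanSpace ℝ ι)⟫_ℝ := by
    conv_lhs => rw [← hv']
    rw [inner_restrict_left_eq, hv']
  rw [hin]
  calc |⟪v, (WithLp.toLp 2 (fun i => if pι i = y then f u i else 0) : EuclideanSpace ℝ ι)⟫_ℝ|
      ≤ ‖v‖ * ‖(WithLp.toLp 2 (fun i => if pι i = y then f u i else 0) : EuclideanSpace ℝ ι)‖ := abs_real_inner_le_norm _ _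
    _ ≤ ‖v‖ * (C * Real.exp (-(δ * ρ y y')) * ‖u‖) := mul_le_mul_of_nonneg_left (h y y' u hu) (norm_nonneg _)
    _ = C * Real.exp (-(δ * ρ y y')) * (‖v‖ * ‖u‖) := by ring

end Abstract

/-! ## §3  [4] (1.114), member `‖ζ∇∇GJ‖`, for `G^{(w′)}`: the `ℓ²`-block bounds of `∇_λ∇_μG^{(w′)}` and `G^{(w′)}∇_μ*∇_λ*` at the scaling -/

section DDGE

variable {d L m K : ℕ} [NeZero L] {hd : 1 ≤ d + 1} {hL : Odd L ∧ 1 < L} {j : ℕ}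
  (hj' : j ≤ (⟨d + 1, L, m, K, hd, hL⟩ : Params).m + (⟨d + 1, L, m, K, hd, hL⟩ : Params).K) (hc : ((L : ℝ) ^ j) ≠ 0) {a : ℝ} (ha : 0 < a) (hw' : (0 : ℝ) < a * ((L : ℝ) ^ j) ^ (d + 1))

include ha in
/-- **`‖(∇_λ∇_μG^{(w′)}u)↾B(y)‖ ≤ const114·e^{−delta114|y − y′|_T}·‖u‖` for `u` supported over `B^j(y′)`** — [4] (1.114), member `m = 4`, for
`G_j = Δ_a⁻¹` on the torus of order `j` (`…B5Local114GLattice.l2locL_le_printed`, every `n = L^j ≥ 1`) with the cut-off `ζ = 1_{B(y)}` (`supp ζ ⊂ Δ̃(y)`,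
`|ζ| ≤ 1`) and the source `ũ` (`supp ũ ⊂ Δ̃(y′)`), its `(λ, μ)` component below the tensor norm, and §1's dictionaries.
[cite: Balaban1984PropagatorsI, Prop. 1.2 (1.114) p.36; Balaban1984PropagatorsII, Prop. 2.5 p.246] -/
theorem norm_blockCut_DDGE_le (lam mu : Fin (d + 1)) (u : BondSpace (⟨d + 1, L, m, K, hd, hL⟩ : Params)) (y y' : Site (⟨d + 1, L, m, K, hd, hL⟩ : Params) j)
    (hu : ∀ b : PBond (⟨d + 1, L, m, K, hd, hL⟩ : Params) 0, iterBlockOf j b.src ≠ y' → u b = 0) :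
    ‖(WithLp.toLp 2 (fun b : PBond (⟨d + 1, L, m, K, hd, hL⟩ : Params) 0 => if iterBlockOf j b.src = y then (((((L : ℝ) ^ j) • (onE (LinearMap.funLeft ℝ ℝ (fun b : PBond (⟨d + 1, L, m, K, hd, hL⟩ : Params) 0 => (⟨b.src.shift lam, b.dir⟩ : PBond (⟨d + 1, L, m, K, hd, hL⟩ : Params) 0))) - LinearMap.id) : BondSpace (⟨d + 1, L, m, K, hd, hL⟩ : Params) →ₗ[ℝ] BondSpace (⟨d + 1, L, m, K, hd, hL⟩ : Params))) ∘ₗ ((((L : ℝ) ^ j) • (onE (LinearMap.funLeft ℝ ℝ (fun b : PBond (⟨d + 1, L, m, K, hd, hL⟩ : Params) 0 => (⟨b.src.shift mu, b.dir⟩ : PBond (⟨d + 1, L, m, K, hd, hL⟩ : Params) 0))) - LinearMap.id) : BondSpace (⟨d + 1, L, m, K, hd, hL⟩ : Params) →ₗ[ℝ] BondSpace (⟨d + 1, L, m, K, hd, hL⟩ : Params))) ∘ₗ (GE (Domains.whole (P := (⟨d + 1, L, m, K, hd, hL⟩ : Params)) j hj') hc (w := fun _ => a * ((L : ℝ) ^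 j) ^ (d + 1)) (fun _ => hw'))) u b else 0) : BondSpace (⟨d + 1, L, m, K, hd, hL⟩ : Params))‖ ≤
      const114 (d + 1) a * Real.exp (-(delta114 (d + 1) a * torusSupNorm (Mk (⟨d + 1, L, m, K, hd, hL⟩ : Params) j) (rep (Mk (⟨d + 1, L, m, K, hd, hL⟩ : Params) j) y - rep (Mk (⟨d + 1, L, m, K, hd, hL⟩ : Params) j) y'))) * ‖u‖ := by
  have hn : 1 ≤ L ^ j := Nat.one_le_pow _ _ (Nat.pos_of_ne_zero (NeZero.ne L))
  -- the cut-off: the indicator of the block of `y`, read on the torus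
  obtain ⟨ζ, hζ⟩ : ∃ ζ : Tor (fine (L ^ j) (Mk (⟨d + 1, L, m, K, hd, hL⟩ : Params) j)) → ℝ, ζ = fun z => if iterBlockOf j ((EK hj').symm z) = y then (1 : ℝ) else 0 := ⟨_, rfl⟩
  have hcut : cutInL (L ^ j) (Mk (⟨d + 1, L, m, K, hd, hL⟩ : Params) j) ζ y := by
    intro z hz
    simp only [hζ] at hz
    have hzy : iterBlockOf j ((EK hj').symm z) = y := by
      by_contra h
      exact hz (if_neg h)
    have hmem := EK_mem_cubeT_blk hj' ((EK hj').symm z)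
    rw [Equiv.apply_symm_apply, hzy] at hmem
    exact hmem
  have hsup : cutSupL (L ^ j) (Mk (⟨d + 1, L, m, K, hd, hL⟩ : Params) j) ζ ≤ 1 := by
    show supNorm Finset.univ ζ ≤ 1
    refine supNorm_le zero_le_one fun z _ => ?_
    rw [hζ, Real.norm_eq_abs]
    dsimp only
    split_ifs <;> simp
  -- the source: `u` read on the torus, supported in the cube of `y′`
  have hsuppT : suppInL (L ^ j) (Mk (⟨d + 1, L, m, K, hd, hL⟩ : Params) j) (Loc189.vec (TV hj' u)) y' := by
    intro b hb
    obtain ⟨z, κ⟩ := b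
    rw [TV_apply] at hb
    have hub : u ⟨(EK hj').symm z, κ⟩ ≠ 0 := fun h0 => hb (by rw [h0, Complex.ofReal_zero])
    have hblk : iterBlockOf j ((EK hj').symm z) = y' := by
      by_contra h
      exact hub (hu _ h)
    have hmem := EK_mem_cubeT_blk hj' ((EK hj').symm z)
    rw [Equiv.apply_symm_apply, hblk] at hmem
    exact hmem
  -- [4] (1.114), member `m = 4`, by name
  have h := l2locL_le_printed (L ^ j) (Mk (⟨d + 1, L, m, K, hd, hL⟩ : Params) j) hn ha 4 (Loc189.vec (TV hj' u)) ζ hcut hsuppT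
  rw [l2locL_four_vec] at h
  -- the `(λ, μ)` component below the tensor norm
  have hcomp : l2 (smulT (L ^ j) (Mk (⟨d + 1, L, m, K, hd, hL⟩ : Params) j) ζ (grad2 (L ^ j) (Mk (⟨d + 1, L, m, K, hd, hL⟩ : Params) j) ((DeltaA (L ^ j) (Mk (⟨d + 1, L, m, K, hd, hL⟩ : Params) j) a)⁻¹ *ᵥ TV hj' u)) (lam, mu)) ≤
      l2T (smulT (L ^ j) (Mk (⟨d + 1, L, m, K, hd, hL⟩ : Params) j) ζ (grad2 (L ^ j) (Mk (⟨d + 1, L, m, K, hd, hL⟩ : Params) j) ((DeltaA (L ^ j) (Mk (⟨d + 1, L, m, K, hd, hL⟩ : Params) j) a)⁻¹ *ᵥ TV hj' u))) := by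
    rw [l2, l2T]
    exact Real.sqrt_le_sqrt (Finset.single_le_sum (fun p _ => nsq_nonneg _) (Finset.mem_univ (lam, mu)))
  -- the component IS the block cut of `∇_λ∇_μG^{(w′)}u` read on the torus
  have hid : smulT (L ^ j) (Mk (⟨d + 1, L, m, K, hd, hL⟩ : Params) j) ζ (grad2 (L ^ j) (Mk (⟨d + 1, L, m, K, hd, hL⟩ : Params) j) ((DeltaA (L ^ j) (Mk (⟨d + 1, L, m, K, hd, hL⟩ : Params) j) a)⁻¹ *ᵥ TV hj' u)) (lam, mu) =
      TV hj' (WithLp.toLp 2 (fun b : PBond (⟨d + 1, L, m, K, hd, hL⟩ : Params) 0 => if iterBlockOf j b.src = y then (((((L : ℝ) ^ j) • (onE (LinearMap.funLeft ℝ ℝ (fun b : PBond (⟨d + 1, L, m, K, hd, hL⟩ : Params) 0 => (⟨b.src.shift lam, b.dir⟩ : PBond (⟨d + 1, L, m, K, hd, hL⟩ : Params) 0))) - LinearMap.id) : BondSpace (⟨d + 1, L, m, K, hd, hL⟩ : Params) →ₗ[ℝ] BondSpace (⟨d + 1, L, m, K, hd, hL⟩ : Params))) ∘ₗ ((((L :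 ℝ) ^ j) • (onE (LinearMap.funLeft ℝ ℝ (fun b : PBond (⟨d + 1, L, m, K, hd, hL⟩ : Params) 0 => (⟨b.src.shift mu, b.dir⟩ : PBond (⟨d + 1, L, m, K, hd, hL⟩ : Params) 0))) - LinearMap.id) : BondSpace (⟨d + 1, L, m, K, hd, hL⟩ : Params) →ₗ[ℝ] BondSpace (⟨d + 1, L, m, K, hd, hL⟩ : Params))) ∘ₗ (GE (Domains.whole (P := (⟨d + 1, L, m, K, hd, hL⟩ : Params)) j hj') hc (w := fun _ => a * ((L : ℝ) ^ j) ^ (d + 1)) (fun _ => hw'))) u b else 0)) := by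
    rw [hζ, TV_blockCut hj', LinearMap.comp_apply, LinearMap.comp_apply, TV_D hj', TV_D hj',
      TV_GE hj' (Domains.whole (P := (⟨d + 1, L, m, K, hd, hL⟩ : Params)) j hj') (qpE_whole_eq_zero_iff hj') (fun _ => hw') ha (inner_QE_aE_whole hj' a) u]
    rfl
  have hnorm : l2 (smulT (L ^ j) (Mk (⟨d + 1, L, m, K, hd, hL⟩ : Params) j) ζ (grad2 (L ^ j) (Mk (⟨d + 1, L, m, K, hd, hL⟩ : Params) j) ((DeltaA (L ^ j) (Mk (⟨d + 1, L, m, K, hd, hL⟩ : Params) j) a)⁻¹ *ᵥ TV hj' u)) (lam, mu)) =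
      ‖(WithLp.toLp 2 (fun b : PBond (⟨d + 1, L, m, K, hd, hL⟩ : Params) 0 => if iterBlockOf j b.src = y then (((((L : ℝ) ^ j) • (onE (LinearMap.funLeft ℝ ℝ (fun b : PBond (⟨d + 1, L, m, K, hd, hL⟩ : Params) 0 => (⟨b.src.shift lam, b.dir⟩ : PBond (⟨d + 1, L, m, K, hd, hL⟩ : Params) 0))) - LinearMap.id) : BondSpace (⟨d + 1, L, m, K, hd, hL⟩ : Params) →ₗ[ℝ] BondSpace (⟨d + 1, L, m, K, hd, hL⟩ : Params))) ∘ₗ ((((L : ℝ) ^ j) • (onE (LinearMap.funLeft ℝ ℝ (fun b : PBond (⟨d + 1, L, m, K, hd, hL⟩ : Params) 0 => (⟨b.src.shift mu, b.dir⟩ : PBond (⟨d + 1, L, m, K, hd, hL⟩ : Params) 0))) - LinearMap.id) : BondSpace (⟨d + 1, L, m, K, hd, hL⟩ : Params) →ₗ[ℝ] BondSpace (⟨d + 1, L, m, K, hd, hL⟩ : Params))) ∘ₗ (GE (Domains.whole (P := (⟨d + 1, L, m, K, hd, hL⟩ : Params)) j hj') hc (w := fun _ => a * ((L : ℝ) ^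 j) ^ (d + 1)) (fun _ => hw'))) u b else 0) : BondSpace (⟨d + 1, L, m, K, hd, hL⟩ : Params))‖ := by
    rw [hid, l2_TV]
  have hloc : locNorm (Loc189.vec (TV hj' u)) = ‖u‖ := by
    show l2 (TV hj' u) = ‖u‖
    exact l2_TV hj' u
  have hdist : distSite (Mk (⟨d + 1, L, m, K, hd, hL⟩ : Params) j) y y' = torusSupNorm (Mk (⟨d + 1, L, m, K, hd, hL⟩ : Params) j) (rep (Mk (⟨d + 1, L, m, K, hd, hL⟩ : Params) j) y - rep (Mk (⟨d + 1, L, m, K, hd, hL⟩ : Params) j) y') := by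
    rw [← supDist_cast_eq_distSite, supDist_cast_eq_torusSupNorm]
  have hCE : 0 ≤ const114 (d + 1) a * Real.exp (-(delta114 (d + 1) a * distSite (Mk (⟨d + 1, L, m, K, hd, hL⟩ : Params) j) y y')) :=
    mul_nonneg (const114_pos _ _).le (Real.exp_pos _).le
  rw [← hnorm, ← hdist]
  calc l2 (smulT (L ^ j) (Mk (⟨d + 1, L, m, K, hd, hL⟩ : Params) j) ζ (grad2 (L ^ j) (Mk (⟨d + 1, L, m, K, hd, hL⟩ : Params) j) ((DeltaA (L ^ j) (Mk (⟨d + 1, L, m, K, hd, hL⟩ : Params) j) a)⁻¹ *ᵥ TV hj' u)) (lam, mu))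
      ≤ l2T (smulT (L ^ j) (Mk (⟨d + 1, L, m, K, hd, hL⟩ : Params) j) ζ (grad2 (L ^ j) (Mk (⟨d + 1, L, m, K, hd, hL⟩ : Params) j) ((DeltaA (L ^ j) (Mk (⟨d + 1, L, m, K, hd, hL⟩ : Params) j) a)⁻¹ *ᵥ TV hj' u))) := hcomp
    _ ≤ const114 (d + 1) a * Real.exp (-(delta114 (d + 1) a * distSite (Mk (⟨d + 1, L, m, K, hd, hL⟩ : Params) j) y y')) * cutSupL (L ^ j) (Mk (⟨d + 1, L, m, K, hd, hL⟩ : Params) j) ζ *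
          locNorm (Loc189.vec (TV hj' u)) := h
    _ ≤ const114 (d + 1) a * Real.exp (-(delta114 (d + 1) a * distSite (Mk (⟨d + 1, L, m, K, hd, hL⟩ : Params) j) y y')) * 1 * ‖u‖ := by
        rw [hloc]
        exact mul_le_mul_of_nonneg_right (mul_le_mul_of_nonneg_left hsup hCE) (norm_nonneg _)
    _ = const114 (d + 1) a * Real.exp (-(delta114 (d + 1) a * distSite (Mk (⟨d + 1, L, m, K, hd, hL⟩ : Params) j) y y')) * ‖u‖ := by rw [mul_one]

include ha in
/-- **THE `ℓ²`-BLOCK BOUND OF `∇_λ∇_μG^{(w′)}` AT THE SCALING**, every volume, every `0 ≤ j ≤ m + K`: for fine bond fields `v` over `B^j(y)` and `u` over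
`B^j(y′)`, `|⟨v, ∇_λ∇_μG^{(w′)}u⟩| ≤ const114·e^{−delta114|y − y′|_T}·‖v‖‖u‖` (file 23's shape; §2 on `norm_blockCut_DDGE_le`).
[cite: Balaban1984PropagatorsI, Prop. 1.2 (1.114) p.36; Balaban1984PropagatorsII, Prop. 2.5 p.246] -/
theorem l2blk_DDGE_scaling (lam mu : Fin (d + 1)) (y y' : Site (⟨d + 1, L, m, K, hd, hL⟩ : Params) j) (v u : BondSpace (⟨d + 1, L, m, K, hd, hL⟩ : Params))
    (hv : ∀ b : PBond (⟨d + 1, L, m, K, hd, hL⟩ : Params) 0, iterBlockOf j b.src ≠ y → v b = 0) (hu : ∀ b : PBond (⟨d + 1, L, m, K, hd, hL⟩ : Params) 0, iterBlockOf j b.src ≠ y' → u b = 0) :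
    |⟪v, (((((L : ℝ) ^ j) • (onE (LinearMap.funLeft ℝ ℝ (fun b : PBond (⟨d + 1, L, m, K, hd, hL⟩ : Params) 0 => (⟨b.src.shift lam, b.dir⟩ : PBond (⟨d + 1, L, m, K, hd, hL⟩ : Params) 0))) - LinearMap.id) : BondSpace (⟨d + 1, L, m, K, hd, hL⟩ : Params) →ₗ[ℝ] BondSpace (⟨d + 1, L, m, K, hd, hL⟩ : Params))) ∘ₗ ((((L : ℝ) ^ j) • (onE (LinearMap.funLeft ℝ ℝ (fun b : PBond (⟨d + 1, L, m, K, hd, hL⟩ : Params) 0 => (⟨b.src.shift mu, b.dir⟩ : PBond (⟨d + 1, L, m, K, hd, hL⟩ : Params) 0))) - LinearMap.id) : BondSpace (⟨d + 1, L, m, K, hd, hL⟩ : Params) →ₗ[ℝ] BondSpace (⟨d + 1, L, m, K, hd, hL⟩ : Params))) ∘ₗ (GE (Domains.whole (P := (⟨d + 1, L, m, K, hd, hL⟩ : Params)) j hj') hc (w := fun _ => a * ((L : ℝ) ^ j) ^ (d + 1)) (fun _ => hw'))) u⟫_ℝ| ≤ const114 (d + 1) a * Real.exp (-(delta114 (d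 + 1) a * torusSupNorm (Mk (⟨d + 1, L, m, K, hd, hL⟩ : Params) j) (rep (Mk (⟨d + 1, L, m, K, hd, hL⟩ : Params) j) y - rep (Mk (⟨d + 1, L, m, K, hd, hL⟩ : Params) j) y'))) * (‖v‖ * ‖u‖) :=
  l2blk_of_norm_restrict_le (ρ := (fun t t' : Site (⟨d + 1, L, m, K, hd, hL⟩ : Params) j => torusSupNorm (Mk (⟨d + 1, L, m, K, hd, hL⟩ : Params) j) (rep (Mk (⟨d + 1, L, m, K, hd, hL⟩ : Params) j) t - rep (Mk (⟨d + 1, L, m, K, hd, hL⟩ : Params) j) t'))) (((((L : ℝ) ^ j) • (onE (LinearMap.funLeft ℝ ℝ (fun b : PBond (⟨d + 1, L, m, K, hd, hL⟩ : Params) 0 => (⟨b.src.shift lam, b.dir⟩ : PBond (⟨d + 1, L, m, K, hd, hL⟩ : Params) 0))) - LinearMap.id) : BondSpace (⟨d + 1, L, m, K, hd, hL⟩ : Params) →ₗ[ℝ] BondSpace (⟨d + 1, L, m, K, hd, hL⟩ : Params))) ∘ₗ ((((L : ℝ) ^ j) • (onE (LinearMap.funLeft ℝ ℝ (fun b : PBond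 (⟨d + 1, L, m, K, hd, hL⟩ : Params) 0 => (⟨b.src.shift mu, b.dir⟩ : PBond (⟨d + 1, L, m, K, hd, hL⟩ : Params) 0))) - LinearMap.id) : BondSpace (⟨d + 1, L, m, K, hd, hL⟩ : Params) →ₗ[ℝ] BondSpace (⟨d + 1, L, m, K, hd, hL⟩ : Params))) ∘ₗ (GE (Domains.whole (P := (⟨d + 1, L, m, K, hd, hL⟩ : Params)) j hj') hc (w := fun _ => a * ((L : ℝ) ^ j) ^ (d + 1)) (fun _ => hw'))) (fun b₀ : PBond (⟨d + 1, L, m, K, hd, hL⟩ : Params) 0 => iterBlockOf j b₀.src) (fun b₀ : PBond (⟨d + 1, L, m, K, hd, hL⟩ : Params) 0 => iterBlockOf j b₀.src)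
    (fun y₁ y₂ u' hu' => norm_blockCut_DDGE_le hj' hc ha hw' lam mu u' y₁ y₂ hu') y y' v u hv hu

omit [NeZero L] in
/-- `G^{(w′)}` is self-adjoint (r03's `inner_GE_left`). [cite: Balaban1984PropagatorsII, (2.22) p.226; Balaban1984PropagatorsI, Prop. 1.1 p.33 («G is a symmetric operator»)] -/
theorem adjoint_GEW : LinearMap.adjoint (GE (Domains.whole (P := (⟨d + 1, L, m, K, hd, hL⟩ : Params)) j hj') hc (w := fun _ => a * ((L : ℝ) ^ j) ^ (d + 1)) (fun _ => hw')) = (GE (Domains.whole (P := (⟨d + 1, L, m, K, hd, hL⟩ : Params)) j hj') hc (w := fun _ => a * ((L : ℝ) ^ j) ^ (d + 1)) (fun _ => hw')) :=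
  ((LinearMap.eq_adjoint_iff _ _).2 fun x y => inner_GE_left (Domains.whole (P := (⟨d + 1, L, m, K, hd, hL⟩ : Params)) j hj') hc (fun _ => hw') x y).symm

omit [NeZero L] in
/-- `(∇_λ∇_μG^{(w′)})* = G^{(w′)}∇_μ*∇_λ*` (p22's `adjoint_Dop`). [cite: Balaban1984PropagatorsI, (1.89) p.33 («G∇*∇*J»)] -/
theorem adjoint_DDGE (lam mu : Fin (d + 1)) :
    LinearMap.adjoint (((((L : ℝ) ^ j) • (onE (LinearMap.funLeft ℝ ℝ (fun b : PBond (⟨d + 1, L, m, K, hd, hL⟩ : Params) 0 => (⟨b.src.shift lam, b.dir⟩ : PBond (⟨d + 1, L, m, K, hd, hL⟩ : Params) 0))) - LinearMap.id) : BondSpace (⟨d + 1, L, m, K, hd, hL⟩ : Params) →ₗ[ℝ] BondSpace (⟨d + 1, L, m, K, hd, hL⟩ : Params))) ∘ₗ ((((L : ℝ) ^ j) • (onE (LinearMap.funLeft ℝ ℝ (fun b : PBond (⟨d + 1, L, m, K, hd, hL⟩ : Params) 0 => (⟨b.src.shift mu, b.dir⟩ : PBond (⟨d + 1, L, m, K,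 hd, hL⟩ : Params) 0))) - LinearMap.id) : BondSpace (⟨d + 1, L, m, K, hd, hL⟩ : Params) →ₗ[ℝ] BondSpace (⟨d + 1, L, m, K, hd, hL⟩ : Params))) ∘ₗ (GE (Domains.whole (P := (⟨d + 1, L, m, K, hd, hL⟩ : Params)) j hj') hc (w := fun _ => a * ((L : ℝ) ^ j) ^ (d + 1)) (fun _ => hw'))) = (GE (Domains.whole (P := (⟨d + 1, L, m, K, hd, hL⟩ : Params)) j hj') hc (w := fun _ => a * ((L : ℝ) ^ j) ^ (d + 1)) (fun _ => hw')) ∘ₗ ((((L : ℝ) ^ j) • (onE (LinearMap.funLeft ℝ ℝ (fun b : PBond (⟨d + 1, L, m, K, hd, hL⟩ : Params) 0 => (⟨b.src.unshift mu, b.dir⟩ : PBond (⟨d + 1, L, m, K, hd, hL⟩ : Params) 0))) - LinearMap.id) : BondSpace (⟨d + 1, L, m, K, hd, hL⟩ : Params) →ₗ[ℝ] BondSpace (⟨d + 1, L, m, K, hd, hL⟩ : Params))) ∘ₗ ((((L : ℝ) ^ j) • (onE (LinearMap.funLeft ℝ ℝ (fun b : PBond (⟨d + 1, L, m, K, hd,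 hL⟩ : Params) 0 => (⟨b.src.unshift lam, b.dir⟩ : PBond (⟨d + 1, L, m, K, hd, hL⟩ : Params) 0))) - LinearMap.id) : BondSpace (⟨d + 1, L, m, K, hd, hL⟩ : Params) →ₗ[ℝ] BondSpace (⟨d + 1, L, m, K, hd, hL⟩ : Params))) := by
  rw [LinearMap.adjoint_comp, LinearMap.adjoint_comp, adjoint_Dop, adjoint_Dop, adjoint_GEW, LinearMap.comp_assoc]

include ha in
/-- **THE `ℓ²`-BLOCK BOUND OF `G^{(w′)}∇_μ*∇_λ*` AT THE SCALING** (the member `‖ζG∇*∇*J‖` of (1.114) in block form, by adjunction from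
`l2blk_DDGE_scaling`: file 23's `l2blk_adjoint`). [cite: Balaban1984PropagatorsI, Prop. 1.2 (1.114) p.36; Balaban1984PropagatorsII, Prop. 2.5 p.246] -/
theorem l2blk_GEDadjDadj_scaling (lam mu : Fin (d + 1)) (y y' : Site (⟨d + 1, L, m, K, hd, hL⟩ : Params) j) (v u : BondSpace (⟨d + 1, L, m, K, hd, hL⟩ : Params))
    (hv : ∀ b : PBond (⟨d + 1, L, m, K, hd, hL⟩ : Params) 0, iterBlockOf j b.src ≠ y → v b = 0) (hu : ∀ b : PBond (⟨d + 1, L, m, K, hd, hL⟩ : Params) 0, iterBlockOf j b.src ≠ y' → u b = 0) :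
    |⟪v, ((GE (Domains.whole (P := (⟨d + 1, L, m, K, hd, hL⟩ : Params)) j hj') hc (w := fun _ => a * ((L : ℝ) ^ j) ^ (d + 1)) (fun _ => hw')) ∘ₗ ((((L : ℝ) ^ j) • (onE (LinearMap.funLeft ℝ ℝ (fun b : PBond (⟨d + 1, L, m, K, hd, hL⟩ : Params) 0 => (⟨b.src.unshift mu, b.dir⟩ : PBond (⟨d + 1, L, m, K, hd, hL⟩ : Params) 0))) - LinearMap.id) : BondSpace (⟨d + 1, L, m, K, hd, hL⟩ : Params) →ₗ[ℝ] BondSpace (⟨d + 1, L, m, K, hd, hL⟩ : Params))) ∘ₗ ((((L : ℝ) ^ j) • (onE (LinearMap.funLeft ℝ ℝ (fun b : PBond (⟨d + 1, L, m, K, hd, hL⟩ : Params) 0 => (⟨b.src.unshift lam, b.dir⟩ : PBond (⟨d + 1, L, m, K, hd, hL⟩ : Params) 0))) - LinearMap.id) : BondSpace (⟨d + 1, L, m, K, hd, hL⟩ : Params) →ₗ[ℝ] BondSpace (⟨d + 1, L, m, K, hd, hL⟩ : Params)))) u⟫_ℝ| ≤ const114 (d + 1) a * Real.exp (-(delta114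 (d + 1) a * torusSupNorm (Mk (⟨d + 1, L, m, K, hd, hL⟩ : Params) j) (rep (Mk (⟨d + 1, L, m, K, hd, hL⟩ : Params) j) y - rep (Mk (⟨d + 1, L, m, K, hd, hL⟩ : Params) j) y'))) * (‖v‖ * ‖u‖) := by
  rw [← adjoint_DDGE hj' hc hw']
  exact l2blk_adjoint (torusDist_isPseudoDist (Mk (⟨d + 1, L, m, K, hd, hL⟩ : Params) j)) (((((L : ℝ) ^ j) • (onE (LinearMap.funLeft ℝ ℝ (fun b : PBond (⟨d + 1, L, m, K, hd, hL⟩ : Params) 0 => (⟨b.src.shift lam, b.dir⟩ : PBond (⟨d + 1, L, m, K, hd, hL⟩ : Params) 0))) - LinearMap.id) : BondSpace (⟨d + 1, L, m, K, hd, hL⟩ : Params) →ₗ[ℝ] BondSpace (⟨d + 1, L, m, K, hd, hL⟩ : Params))) ∘ₗ ((((L : ℝ) ^ j) • (onE (LinearMap.funLeft ℝ ℝ (fun b : PBond (⟨d + 1, L, m, K, hd, hL⟩ : Params) 0 => (⟨b.src.shift mu, b.dir⟩ : PBond (⟨d + 1, L, m, K, hd, hL⟩ : Params) 0))) - LinearMap.id)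 : BondSpace (⟨d + 1, L, m, K, hd, hL⟩ : Params) →ₗ[ℝ] BondSpace (⟨d + 1, L, m, K, hd, hL⟩ : Params))) ∘ₗ (GE (Domains.whole (P := (⟨d + 1, L, m, K, hd, hL⟩ : Params)) j hj') hc (w := fun _ => a * ((L : ℝ) ^ j) ^ (d + 1)) (fun _ => hw'))) (fun b₀ : PBond (⟨d + 1, L, m, K, hd, hL⟩ : Params) 0 => iterBlockOf j b₀.src) (fun b₀ : PBond (⟨d + 1, L, m, K, hd, hL⟩ : Params) 0 => iterBlockOf j b₀.src)
    (fun y₁ y₂ v' u' hv' hu' => l2blk_DDGE_scaling hj' hc ha hw' lam mu y₁ y₂ v' u' hv' hu') y y' v u hv hu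

end DDGE

/-! ## §4  [4] (1.114), member `‖ζ∇G∇*J‖`, for `G^{(w′)}`: the `ℓ²`-block bound of `∇_λG^{(w′)}∇_μ*` at the scaling -/

section DGEDadj

variable {d L m K : ℕ} [NeZero L] {hd : 1 ≤ d + 1} {hL : Odd L ∧ 1 < L} {j : ℕ}
  (hj' : j ≤ (⟨d + 1, L, m, K, hd, hL⟩ : Params).m + (⟨d + 1, L, m, K, hd, hL⟩ : Params).K) (hc : ((L : ℝ) ^ j) ≠ 0) {a : ℝ} (ha : 0 < a) (hw' : (0 : ℝ) < a * ((L : ℝ) ^ j) ^ (d + 1))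

include ha in
/-- **`‖(∇_λG^{(w′)}∇_μ*u)↾B(y)‖ ≤ const114·e^{−delta114|y − y′|_T}·‖u‖` for `u` supported over `B^j(y′)`** — [4] (1.114), member `m = 3`, for `G_j` on the
tensor source `T_ν = δ_{νμ}ũ` (`∇*T = ∇_μ*ũ`, `‖T‖ = ‖u‖`, `supp T ⊂ Δ̃(y′)`), cut-off `1_{B(y)}`, component `λ`.
[cite: Balaban1984PropagatorsI, Prop. 1.2 (1.114) p.36; Balaban1984PropagatorsII, Prop. 2.5 p.246] -/
theorem norm_blockCut_DGEDadj_le (lam mu : Fin (d + 1)) (u : BondSpace (⟨d + 1, L, m, K, hd, hL⟩ : Params)) (y y' : Site (⟨d + 1, L, m, K, hd, hL⟩ : Params) j)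
    (hu : ∀ b : PBond (⟨d + 1, L, m, K, hd, hL⟩ : Params) 0, iterBlockOf j b.src ≠ y' → u b = 0) :
    ‖(WithLp.toLp 2 (fun b : PBond (⟨d + 1, L, m, K, hd, hL⟩ : Params) 0 => if iterBlockOf j b.src = y then (((((L : ℝ) ^ j) • (onE (LinearMap.funLeft ℝ ℝ (fun b : PBond (⟨d + 1, L, m, K, hd, hL⟩ : Params) 0 => (⟨b.src.shift lam, b.dir⟩ : PBond (⟨d + 1, L, m, K, hd, hL⟩ : Params) 0))) - LinearMap.id) : BondSpace (⟨d + 1, L, m, K, hd, hL⟩ : Params) →ₗ[ℝ] BondSpace (⟨d + 1, L, m, K, hd, hL⟩ : Params))) ∘ₗ (GE (Domains.whole (P := (⟨d + 1, L, m, K, hd, hL⟩ : Params)) j hj') hc (w := fun _ => a * ((L : ℝ) ^ j) ^ (d + 1)) (fun _ => hw')) ∘ₗ ((((L : ℝ) ^ j) • (onE (LinearMap.funLeft ℝ ℝ (fun b : PBond (⟨d + 1, L, m, K, hd, hL⟩ : Params) 0 => (⟨b.src.unshift mu, b.dir⟩ : PBond (⟨d + 1, L, m, K, hd, hL⟩ :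 Params) 0))) - LinearMap.id) : BondSpace (⟨d + 1, L, m, K, hd, hL⟩ : Params) →ₗ[ℝ] BondSpace (⟨d + 1, L, m, K, hd, hL⟩ : Params)))) u b else 0) : BondSpace (⟨d + 1, L, m, K, hd, hL⟩ : Params))‖ ≤
      const114 (d + 1) a * Real.exp (-(delta114 (d + 1) a * torusSupNorm (Mk (⟨d + 1, L, m, K, hd, hL⟩ : Params) j) (rep (Mk (⟨d + 1, L, m, K, hd, hL⟩ : Params) j) y - rep (Mk (⟨d + 1, L, m, K, hd, hL⟩ : Params) j) y'))) * ‖u‖ := by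
  have hn : 1 ≤ L ^ j := Nat.one_le_pow _ _ (Nat.pos_of_ne_zero (NeZero.ne L))
  obtain ⟨ζ, hζ⟩ : ∃ ζ : Tor (fine (L ^ j) (Mk (⟨d + 1, L, m, K, hd, hL⟩ : Params) j)) → ℝ, ζ = fun z => if iterBlockOf j ((EK hj').symm z) = y then (1 : ℝ) else 0 := ⟨_, rfl⟩
  have hcut : cutInL (L ^ j) (Mk (⟨d + 1, L, m, K, hd, hL⟩ : Params) j) ζ y := by
    intro z hz
    simp only [hζ] at hz
    have hzy : iterBlockOf j ((EK hj').symm z) = y := by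
      by_contra h
      exact hz (if_neg h)
    have hmem := EK_mem_cubeT_blk hj' ((EK hj').symm z)
    rw [Equiv.apply_symm_apply, hzy] at hmem
    exact hmem
  have hsup : cutSupL (L ^ j) (Mk (⟨d + 1, L, m, K, hd, hL⟩ : Params) j) ζ ≤ 1 := by
    show supNorm Finset.univ ζ ≤ 1
    refine supNorm_le zero_le_one fun z _ => ?_
    rw [hζ, Real.norm_eq_abs]
    dsimp only
    split_ifs <;> simp
  -- the tensor source `T_ν = δ_{νμ}ũ`
  obtain ⟨T, hT⟩ : ∃ T : Fin (d + 1) → (Tor (fine (L ^ j) (Mk (⟨d + 1, L, m, K, hd, hL⟩ : Params) j)) × Fin (d + 1) → ℂ), T = fun ν => if ν = mu then TV hj' u else 0 := ⟨_, rfl⟩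
  have hsuppT : suppInL (L ^ j) (Mk (⟨d + 1, L, m, K, hd, hL⟩ : Params) j) (Loc189.ten T) y' := by
    intro ν b hb
    rw [hT] at hb
    by_cases hν : ν = mu
    · simp only [hν, if_true] at hb
      obtain ⟨z, κ⟩ := b
      rw [TV_apply] at hb
      have hub : u ⟨(EK hj').symm z, κ⟩ ≠ 0 := fun h0 => hb (by rw [h0, Complex.ofReal_zero])
      have hblk : iterBlockOf j ((EK hj').symm z) = y' := by
        by_contra h
        exact hub (hu _ h)
      have hmem := EK_mem_cubeT_blk hj' ((EK hj').symm z)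
      rw [Equiv.apply_symm_apply, hblk] at hmem
      exact hmem
    · simp only [hν, if_false] at hb
      exact absurd rfl hb
  have hdiv : divT (L ^ j) (Mk (⟨d + 1, L, m, K, hd, hL⟩ : Params) j) T = star (fdiff (fine (L ^ j) (Mk (⟨d + 1, L, m, K, hd, hL⟩ : Params) j)) ((L ^ j : ℕ) : ℂ) mu) *ᵥ TV hj' u := by
    rw [hT]
    simp only [divT]
    rw [Finset.sum_eq_single mu]
    · rw [if_pos rfl]
    · intro ν _ hν
      rw [if_neg hν, Matrix.mulVec_zero]
    · intro h
      exact absurd (Finset.mem_univ _) h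
  have hlocT : locNorm (Loc189.ten T) = ‖u‖ := by
    show l2T T = ‖u‖
    have hs : ∑ ν, nsq (T ν) = nsq (TV hj' u) := by
      rw [Finset.sum_eq_single mu]
      · simp [hT]
      · intro ν _ hν
        simp [hT, hν, nsq]
      · intro h
        exact absurd (Finset.mem_univ _) h
    rw [l2T, hs, nsq_TV, Real.sqrt_sq (norm_nonneg _)]
  -- [4] (1.114), member `m = 3`, by name
  have h := l2locL_le_printed (L ^ j) (Mk (⟨d + 1, L, m, K, hd, hL⟩ : Params) j) hn ha 3 (Loc189.ten T) ζ hcut hsuppT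
  rw [l2locL_three_ten] at h
  have hcomp : l2 (smulT (L ^ j) (Mk (⟨d + 1, L, m, K, hd, hL⟩ : Params) j) ζ (grad (L ^ j) (Mk (⟨d + 1, L, m, K, hd, hL⟩ : Params) j) ((DeltaA (L ^ j) (Mk (⟨d + 1, L, m, K, hd, hL⟩ : Params) j) a)⁻¹ *ᵥ divT (L ^ j) (Mk (⟨d + 1, L, m, K, hd, hL⟩ : Params) j) T)) lam) ≤
      l2T (smulT (L ^ j) (Mk (⟨d + 1, L, m, K, hd, hL⟩ : Params) j) ζ (grad (L ^ j) (Mk (⟨d + 1, L, m, K, hd, hL⟩ : Params) j) ((DeltaA (L ^ j) (Mk (⟨d + 1, L, m, K, hd, hL⟩ : Params) j) a)⁻¹ *ᵥ divT (L ^ j) (Mk (⟨d + 1, L, m, K, hd, hL⟩ : Params) j) T))) := by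
    rw [l2, l2T]
    exact Real.sqrt_le_sqrt (Finset.single_le_sum (fun p _ => nsq_nonneg _) (Finset.mem_univ lam))
  have hid : smulT (L ^ j) (Mk (⟨d + 1, L, m, K, hd, hL⟩ : Params) j) ζ (grad (L ^ j) (Mk (⟨d + 1, L, m, K, hd, hL⟩ : Params) j) ((DeltaA (L ^ j) (Mk (⟨d + 1, L, m, K, hd, hL⟩ : Params) j) a)⁻¹ *ᵥ divT (L ^ j) (Mk (⟨d + 1, L, m, K, hd, hL⟩ : Params) j) T)) lam =
      TV hj' (WithLp.toLp 2 (fun b : PBond (⟨d + 1, L, m, K, hd, hL⟩ : Params) 0 => if iterBlockOf j b.src = y then (((((L : ℝ) ^ j) • (onE (LinearMap.funLeft ℝ ℝ (fun b : PBond (⟨d + 1, L, m, K, hd, hL⟩ : Params) 0 => (⟨b.src.shift lam, b.dir⟩ : PBond (⟨d + 1, L, m, K, hd, hL⟩ : Params) 0))) - LinearMap.id) : BondSpace (⟨d + 1, L, m, K, hd, hL⟩ : Params) →ₗ[ℝ] BondSpace (⟨d + 1, L, m, K, hd, hL⟩ : Params))) ∘ₗ (GE (Domains.whole (P := (⟨d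 + 1, L, m, K, hd, hL⟩ : Params)) j hj') hc (w := fun _ => a * ((L : ℝ) ^ j) ^ (d + 1)) (fun _ => hw')) ∘ₗ ((((L : ℝ) ^ j) • (onE (LinearMap.funLeft ℝ ℝ (fun b : PBond (⟨d + 1, L, m, K, hd, hL⟩ : Params) 0 => (⟨b.src.unshift mu, b.dir⟩ : PBond (⟨d + 1, L, m, K, hd, hL⟩ : Params) 0))) - LinearMap.id) : BondSpace (⟨d + 1, L, m, K, hd, hL⟩ : Params) →ₗ[ℝ] BondSpace (⟨d + 1, L, m, K, hd, hL⟩ : Params)))) u b else 0)) := by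
    rw [hζ, TV_blockCut hj', LinearMap.comp_apply, LinearMap.comp_apply, TV_D hj',
      TV_GE hj' (Domains.whole (P := (⟨d + 1, L, m, K, hd, hL⟩ : Params)) j hj') (qpE_whole_eq_zero_iff hj') (fun _ => hw') ha (inner_QE_aE_whole hj' a), TV_Dadj hj', hdiv]
    rfl
  have hnorm : l2 (smulT (L ^ j) (Mk (⟨d + 1, L, m, K, hd, hL⟩ : Params) j) ζ (grad (L ^ j) (Mk (⟨d + 1, L, m, K, hd, hL⟩ : Params) j) ((DeltaA (L ^ j) (Mk (⟨d + 1, L, m, K, hd, hL⟩ : Params) j) a)⁻¹ *ᵥ divT (L ^ j) (Mk (⟨d + 1, L, m, K, hd, hL⟩ : Params) j) T)) lam) =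
      ‖(WithLp.toLp 2 (fun b : PBond (⟨d + 1, L, m, K, hd, hL⟩ : Params) 0 => if iterBlockOf j b.src = y then (((((L : ℝ) ^ j) • (onE (LinearMap.funLeft ℝ ℝ (fun b : PBond (⟨d + 1, L, m, K, hd, hL⟩ : Params) 0 => (⟨b.src.shift lam, b.dir⟩ : PBond (⟨d + 1, L, m, K, hd, hL⟩ : Params) 0))) - LinearMap.id) : BondSpace (⟨d + 1, L, m, K, hd, hL⟩ : Params) →ₗ[ℝ] BondSpace (⟨d + 1, L, m, K, hd, hL⟩ : Params))) ∘ₗ (GE (Domains.whole (P := (⟨d + 1, L, m, K, hd, hL⟩ : Params)) j hj') hc (w := fun _ => a * ((L : ℝ) ^ j) ^ (d + 1)) (fun _ => hw')) ∘ₗ ((((L : ℝ) ^ j) • (onE (LinearMap.funLeft ℝ ℝ (fun b : PBond (⟨d + 1, L, m, K, hd, hL⟩ : Params) 0 => (⟨b.src.unshift mu, b.dir⟩ : PBond (⟨d + 1, L, m, K, hd, hL⟩ : Params) 0))) - LinearMap.id) : BondSpace (⟨d + 1, L, m, K, hd, hL⟩ : Params) →ₗ[ℝ] BondSpace (⟨d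 + 1, L, m, K, hd, hL⟩ : Params)))) u b else 0) : BondSpace (⟨d + 1, L, m, K, hd, hL⟩ : Params))‖ := by
    rw [hid, l2_TV]
  have hdist : distSite (Mk (⟨d + 1, L, m, K, hd, hL⟩ : Params) j) y y' = torusSupNorm (Mk (⟨d + 1, L, m, K, hd, hL⟩ : Params) j) (rep (Mk (⟨d + 1, L, m, K, hd, hL⟩ : Params) j) y - rep (Mk (⟨d + 1, L, m, K, hd, hL⟩ : Params) j) y') := by
    rw [← supDist_cast_eq_distSite, supDist_cast_eq_torusSupNorm]
  have hCE : 0 ≤ const114 (d + 1) a * Real.exp (-(delta114 (d + 1) a * distSite (Mk (⟨d + 1, L, m, K, hd, hL⟩ : Params) j) y y')) :=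
    mul_nonneg (const114_pos _ _).le (Real.exp_pos _).le
  rw [← hnorm, ← hdist]
  calc l2 (smulT (L ^ j) (Mk (⟨d + 1, L, m, K, hd, hL⟩ : Params) j) ζ (grad (L ^ j) (Mk (⟨d + 1, L, m, K, hd, hL⟩ : Params) j) ((DeltaA (L ^ j) (Mk (⟨d + 1, L, m, K, hd, hL⟩ : Params) j) a)⁻¹ *ᵥ divT (L ^ j) (Mk (⟨d + 1, L, m, K, hd, hL⟩ : Params) j) T)) lam)
      ≤ l2T (smulT (L ^ j) (Mk (⟨d + 1, L, m, K, hd, hL⟩ : Params) j) ζ (grad (L ^ j) (Mk (⟨d + 1, L, m, K, hd, hL⟩ : Params) j) ((DeltaA (L ^ j) (Mk (⟨d + 1, L, m, K, hd, hL⟩ : Params) j) a)⁻¹ *ᵥ divT (L ^ j) (Mk (⟨d + 1, L, m, K, hd, hL⟩ : Params) j) T))) := hcomp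
    _ ≤ const114 (d + 1) a * Real.exp (-(delta114 (d + 1) a * distSite (Mk (⟨d + 1, L, m, K, hd, hL⟩ : Params) j) y y')) * cutSupL (L ^ j) (Mk (⟨d + 1, L, m, K, hd, hL⟩ : Params) j) ζ *
          locNorm (Loc189.ten T) := h
    _ ≤ const114 (d + 1) a * Real.exp (-(delta114 (d + 1) a * distSite (Mk (⟨d + 1, L, m, K, hd, hL⟩ : Params) j) y y')) * 1 * ‖u‖ := by
        rw [hlocT]
        exact mul_le_mul_of_nonneg_right (mul_le_mul_of_nonneg_left hsup hCE) (norm_nonneg _)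
    _ = const114 (d + 1) a * Real.exp (-(delta114 (d + 1) a * distSite (Mk (⟨d + 1, L, m, K, hd, hL⟩ : Params) j) y y')) * ‖u‖ := by rw [mul_one]

include ha in
/-- **THE `ℓ²`-BLOCK BOUND OF `∇_λG^{(w′)}∇_μ*` AT THE SCALING**, every volume, every `0 ≤ j ≤ m + K`.
[cite: Balaban1984PropagatorsI, Prop. 1.2 (1.114) p.36; Balaban1984PropagatorsII, Prop. 2.5 p.246] -/
theorem l2blk_DGEDadj_scaling (lam mu : Fin (d + 1)) (y y' : Site (⟨d + 1, L, m, K, hd, hL⟩ : Params) j) (v u : BondSpace (⟨d + 1, L, m, K, hd, hL⟩ : Params))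
    (hv : ∀ b : PBond (⟨d + 1, L, m, K, hd, hL⟩ : Params) 0, iterBlockOf j b.src ≠ y → v b = 0) (hu : ∀ b : PBond (⟨d + 1, L, m, K, hd, hL⟩ : Params) 0, iterBlockOf j b.src ≠ y' → u b = 0) :
    |⟪v, (((((L : ℝ) ^ j) • (onE (LinearMap.funLeft ℝ ℝ (fun b : PBond (⟨d + 1, L, m, K, hd, hL⟩ : Params) 0 => (⟨b.src.shift lam, b.dir⟩ : PBond (⟨d + 1, L, m, K, hd, hL⟩ : Params) 0))) - LinearMap.id) : BondSpace (⟨d + 1, L, m, K, hd, hL⟩ : Params) →ₗ[ℝ] BondSpace (⟨d + 1, L, m, K, hd, hL⟩ : Params))) ∘ₗ (GE (Domains.whole (P := (⟨d + 1, L, m, K, hd, hL⟩ : Params)) j hj') hc (w := fun _ => a * ((L : ℝ) ^ j) ^ (d + 1)) (fun _ => hw')) ∘ₗ ((((L : ℝ) ^ j) • (onE (LinearMap.funLeft ℝ ℝ (fun b : PBond (⟨d + 1, L, m, K, hd, hL⟩ : Params) 0 => (⟨b.src.unshift mu, b.dir⟩ : PBond (⟨d + 1, L, m, K, hd, hL⟩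 : Params) 0))) - LinearMap.id) : BondSpace (⟨d + 1, L, m, K, hd, hL⟩ : Params) →ₗ[ℝ] BondSpace (⟨d + 1, L, m, K, hd, hL⟩ : Params)))) u⟫_ℝ| ≤ const114 (d + 1) a * Real.exp (-(delta114 (d + 1) a * torusSupNorm (Mk (⟨d + 1, L, m, K, hd, hL⟩ : Params) j) (rep (Mk (⟨d + 1, L, m, K, hd, hL⟩ : Params) j) y - rep (Mk (⟨d + 1, L, m, K, hd, hL⟩ : Params) j) y'))) * (‖v‖ * ‖u‖) :=
  l2blk_of_norm_restrict_le (ρ := (fun t t' : Site (⟨d + 1, L, m, K, hd, hL⟩ : Params) j => torusSupNorm (Mk (⟨d + 1, L, m, K, hd, hL⟩ : Params) j) (rep (Mk (⟨d + 1, L, m, K, hd, hL⟩ : Params) j) t - rep (Mk (⟨d + 1, L, m, K, hd, hL⟩ : Params) j) t'))) (((((L : ℝ) ^ j) • (onE (LinearMap.funLeft ℝ ℝ (fun b : PBond (⟨d + 1, L, m, K, hd, hL⟩ : Params) 0 => (⟨b.src.shift lam, b.dir⟩ : PBond (⟨d + 1, L, m, K, hd, hL⟩ : Params) 0))) - LinearMap.id)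 : BondSpace (⟨d + 1, L, m, K, hd, hL⟩ : Params) →ₗ[ℝ] BondSpace (⟨d + 1, L, m, K, hd, hL⟩ : Params))) ∘ₗ (GE (Domains.whole (P := (⟨d + 1, L, m, K, hd, hL⟩ : Params)) j hj') hc (w := fun _ => a * ((L : ℝ) ^ j) ^ (d + 1)) (fun _ => hw')) ∘ₗ ((((L : ℝ) ^ j) • (onE (LinearMap.funLeft ℝ ℝ (fun b : PBond (⟨d + 1, L, m, K, hd, hL⟩ : Params) 0 => (⟨b.src.unshift mu, b.dir⟩ : PBond (⟨d + 1, L, m, K, hd, hL⟩ : Params) 0))) - LinearMap.id) : BondSpace (⟨d + 1, L, m, K, hd, hL⟩ : Params) →ₗ[ℝ] BondSpace (⟨d + 1, L, m, K, hd, hL⟩ : Params)))) (fun b₀ : PBond (⟨d + 1, L, m, K, hd, hL⟩ : Params) 0 => iterBlockOf j b₀.src) (fun b₀ : PBond (⟨d + 1, L, m, K, hd, hL⟩ : Params) 0 => iterBlockOf j b₀.src)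
    (fun y₁ y₂ u' hu' => norm_blockCut_DGEDadj_le hj' hc ha hw' lam mu u' y₁ y₂ hu') y y' v u hv hu

end DGEDadj

end Literature.MathematicalPhysics.QuantumFieldTheory.Balaban1983to89.B6L2Block114GEV1

end
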